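import Mathlib
import Summits.MatrixMultiplication.MatrixMultiplication.Theses.HiddenToeplitzCorners

/-!
# Sketch (crux-ideate round 2, ideator k=5) — typed DISPROOF-SIDE targets for `HiddenCorners`

No idea card was filed this round (every candidate lever met the ω-neutral law under its own cheapest
falsifier; see NOTES.md / barrier-notes.md / quotient-corners.md attached to stmt-MatrixMultiplication-7492).
This file only types the statements those notes recommend to cdisprove / the HCL-R line (stmt-10752):

* `pencil`, `shiftZ` — the route's conventions (re-declared locally for readability).
* `FrameFree` / `AtomFamily` — the new explicit frame-free singular-preserving family ATOM_r (N = 4r − 6),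
  verified exactly for r = 3..8 (exp/atom.py); a calibration instance any "ω-neutral law" proof must cover.
* `OmegaNeutralLaw c` — the conjectured generalisation of `HiddenCornerLemmaR` from frames to ALL mechanisms:
  every generically nonsingular, singularity-preserving pencil of Stein displacement rank ≤ d has r ≤ c·(d+1).
* `omegaNeutral_refutes` — the (routine, real-analysis) implication OmegaNeutralLaw c → ¬ HiddenCorners, stated.
* `sandwich_rank_core` — the linear-algebra core of barrier note B4 (provable now; the design-level
  bookkeeping that produces its hypothesis is in barrier-notes.md §B4).
-/

namespace Summit.MatrixMultiplication.MatrixMultiplication.Cruxes.HiddenCorners.Round2K5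

open scoped BigOperators Matrix
open Summit.MatrixMultiplication.MatrixMultiplication.Theses.HiddenToeplitzCorners

/-- The pencil `T(X) = Σ_ab X_ab • T_ab`. -/
noncomputable def pencil {r N : ℕ} (T : Fin r → Fin r → Matrix (Fin N) (Fin N) ℂ)
    (X : Matrix (Fin r) (Fin r) ℂ) : Matrix (Fin N) (Fin N) ℂ :=
  ∑ a : Fin r, ∑ b : Fin r, X a b • T a b

/-- The lower shift `Z` on `ℂ^N` (route convention). -/
noncomputable def shiftZ (N : ℕ) : Matrix (Fin N) (Fin N) ℂ :=
  Matrix.of fun i j : Fin N => if (i : ℕ) = (j : ℕ) + 1 then (1 : ℂ) else 0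

/-- Singularity-preserving and generically nonsingular ("SP"). -/
def IsSP {r N : ℕ} (T : Fin r → Fin r → Matrix (Fin N) (Fin N) ℂ) : Prop :=
  (∃ X₀ : Matrix (Fin r) (Fin r) ℂ, (pencil T X₀).det ≠ 0) ∧
    ∀ X : Matrix (Fin r) (Fin r) ℂ, X.det = 0 → (pencil T X).det = 0

/-- Stein displacement rank of the pencil is at most `d` for every `X`. -/
def DispLE {r N : ℕ} (T : Fin r → Fin r → Matrix (Fin N) (Fin N) ℂ) (d : ℕ) : Prop :=
  ∀ X : Matrix (Fin r) (Fin r) ℂ, (pencil T X - shiftZ N * pencil T X * (shiftZ N)ᵀ).rank ≤ d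

/-- "Frame-free": no linearly explained rank-`r` corner on the right, for `X` or for `Xᵀ`
(the two readings HCL-R uses). -/
def FrameFree {r N : ℕ} (T : Fin r → Fin r → Matrix (Fin N) (Fin N) ℂ) : Prop :=
  ¬ ∃ (E F : Matrix (Fin N) (Fin r) ℂ), E.rank = r ∧
      ((∀ X : Matrix (Fin r) (Fin r) ℂ, pencil T X * E = F * X) ∨
       (∀ X : Matrix (Fin r) (Fin r) ℂ, pencil T X * E = F * Xᵀ))

/-- The ATOM family (quotient corners / glued Bézout chains): for every `r ≥ 3` there is a frame-free SP pencil of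
size `4r − 6` whose coefficient matrices are 0/1 matrices (each entry of `T(X)` is a single variable or 0).
Verified exactly for `r = 3..8` (exp/atom.py, exp/atom2.py); paper proof of SP in quotient-corners.md §2.
Its Stein displacement rank is `r + 1` in the best layout found — a calibration instance, NOT a crux witness. -/
def AtomFamily : Prop :=
  ∀ r : ℕ, 3 ≤ r → ∃ T : Fin r → Fin r → Matrix (Fin (4 * r - 6)) (Fin (4 * r - 6)) ℂ,
    (∀ a b i j, T a b i j = 0 ∨ T a b i j = 1) ∧ IsSP T ∧ FrameFree T

/-- Conjectured ω-NEUTRAL LAW with constant `c` (generalises `HiddenCornerLemmaR` from frames to all mechanisms):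
every SP pencil of Stein displacement rank ≤ d has `r ≤ c·(d+1)`. The crux `HiddenCorners` needs `d ≤ 2·r^ε`, so any
fixed `c` refutes it (see `omegaNeutral_refutes`). All mechanism classes on record (corners: r ≤ 2d tight; quotient
corners: d ≥ r+1… i.e. r ≤ d; sandwich/Schur designs: d ≥ r/k) satisfy it with c = 2. -/
def OmegaNeutralLaw (c : ℕ) : Prop :=
  ∀ (r N d : ℕ) (T : Fin r → Fin r → Matrix (Fin N) (Fin N) ℂ), IsSP T → DispLE T d → r ≤ c * (d + 1)

/-- The route's kill criterion, typed: a neutral law with any fixed constant refutes the crux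
(routine: take ε = 1/2, r large with r > c·(2r^ε+1)). Stated as a Prop; proof left to a prover/cdisprove. -/
def omegaNeutral_refutes : Prop :=
  ∀ c : ℕ, OmegaNeutralLaw c → ¬ HiddenCorners

/-- Linear-algebra core of barrier note B4 (sandwich rank lemma): if some `r × N` matrices `W, W'` compress the
displacement `∇K` of the constant block `K` to an invertible `r × r` matrix, the displacement rank is at least `r`.
(In B4, `W ∇K W'ᵀ = -M` is DERIVED from "the Schur complement realises X·M·X on the output block", for arbitrary
weighted multi-placements.) Provable now from `Matrix.rank_mul_le`. -/
def sandwich_rank_core : Prop :=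
  ∀ (r N : ℕ) (K : Matrix (Fin N) (Fin N) ℂ) (W W' : Matrix (Fin r) (Fin N) ℂ) (M : Matrix (Fin r) (Fin r) ℂ),
    M.det ≠ 0 → W * (K - shiftZ N * K * (shiftZ N)ᵀ) * W'ᵀ = -M →
      r ≤ (K - shiftZ N * K * (shiftZ N)ᵀ).rank

/-- Sanity: the core lemma is indeed elementary. -/
theorem sandwich_rank_core_holds : sandwich_rank_core := by
  intro r N K W W' M hM h
  have hMu : IsUnit M := (Matrix.isUnit_iff_isUnit_det M).mpr (isUnit_iff_ne_zero.mpr hM)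
  have hrk : (-M).rank = r := by
    simpa using Matrix.rank_of_isUnit (-M) hMu.neg
  have h1 : (W * (K - shiftZ N * K * (shiftZ N)ᵀ) * W'ᵀ).rank ≤ (W * (K - shiftZ N * K * (shiftZ N)ᵀ)).rank :=
    Matrix.rank_mul_le_left _ _
  have h2 : (W * (K - shiftZ N * K * (shiftZ N)ᵀ)).rank ≤ (K - shiftZ N * K * (shiftZ N)ᵀ).rank :=
    Matrix.rank_mul_le_right _ _
  rw [h, hrk] at h1
  omega

end Summit.MatrixMultiplication.MatrixMultiplication.Cruxes.HiddenCorners.Round2K5
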